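import Literature.NumberTheory.Automorphic.IntegralEigenclassHeckePoint
import Literature.NumberTheory.Automorphic.PrincipalPowerTowerLevels
import Literature.NumberTheory.Automorphic.TwistedQuotientRestrictScalars
import HarnessLib

/-!
# An integral eigenclass of bounded content gives a `ℤ̄_p`-point of the big Hecke algebra of the
# `p`-power principal congruence tower

Topic `NumberTheory/Automorphic`; namespace `Literature.NumberTheory.Automorphic` (grouping
sub-namespace `ResGLnCohomology`).  Theorems only: no definition, no named fact, no instance, no
`sorry`.

The generic integral continuity step `TwistedQuotient.isHeckePoint_of_intFun_eigenclass`
(`IntegralEigenclassHeckePoint`: an integral Hecke eigenclass `c ∈ H^q(Γ, M̃)` of bounded content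
is a point of `Spf 𝕋` of a level tower, [Scholze2015, §V.4, proofs of Thm. V.4.1 and Cor. V.4.2],
[Emerton2006, §2.2–2.3]) instantiated in the binders of the named fact
`bianchi_regularAlgebraicCuspidal_isHeckePoint` (`RegularAlgebraicCuspidalHeckePoint`), for any
`GL_n` over any number field `K`:

* scalars `k = ℤ̄_p`, the valuation ring of `ℚ̄_p = PadicAlgCl p` (a valuation ring: divisibility is
  total, `p` is a non-zero-divisor);
* `Γ = GL_n(K) ↪ 𝒢 = GL_n(𝔸_K^∞)` (`BigHeckeGLn.globalEmbedding`), coefficients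
  `V = ⨂_τ V_{λ_τ}(ℚ̄_p)` with `𝒢` acting through its `p`-component
  (`ResGLnCohomology.padicCoeffRep`, restricted to `ℤ̄_p`-scalars by `TwistedQuotient.resScalars`);
* the tower `s ↦ U₀ ∩ K_f((p)^s)` written as in the named fact,
  `LevelTower.ofSeq U₀ (s ↦ K((p)^s).map sndHom)`, under an open compact `U₀ ≤ GL_n(𝒪̂_K)`
  hyperspecial at the good places (`PrincipalPowerTowerLevels` supplies its level data);
* the Hecke elements `t_{v,i} = sndHom (heckeDiagAt n K v ϖ_v i)`, `v` good (so `v ∤ p`),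
  `1 ≤ i ≤ n`, on which the coefficient representation is trivial
  (`ResGLnCohomology.padicCoeffRep_sndHom_heckeDiagAt`).

Main result `ResGLnCohomology.isHeckePoint_principalPowerTower_of_intFun_eigenclass`: given a
`ℤ̄_p`-lattice `M ⊂ V`, free of finite rank and stable under `U₀`, on whose reduction modulo
`p^{t'}` some level `U₀ ∩ K_f((p)^r)` acts trivially (for every `t'`), and an eigenclass
`c ∈ H^q(GL_n(K), M̃)` of all `[U₀ t_{v,i} U₀]` with eigenvalues `b_{v,i} ∈ ℤ̄_p` and content `≤ m₀`,
the family `(t_{v,i}) ↦ (b_{v,i})` IS a Hecke point of the tower in the sense of the named fact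
(`IsHeckePoint`).  What then remains of the named fact is the construction of such an integral
eigenclass from a cuspidal regular algebraic `π` (Eichler–Shimura–Harder, lattices, bounded
denominators: [Scholze2015, §V.4, proof of Thm. V.4.1]).

## References

* P. Scholze, *On torsion in the cohomology of locally symmetric varieties*, Ann. of Math. 182
  (2015), §V.4, Thm. V.4.1, Cor. V.4.2 [Scholze2015].
* M. Emerton, *On the interpolation of systems of eigenvalues attached to automorphic Hecke
  eigenforms*, Invent. Math. 164 (2006), §2.2–2.3 [Emerton2006].
-/

noncomputable section

open CategoryTheory
open scoped NumberField
open IsDedekindDomain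

namespace Literature.NumberTheory.Automorphic

namespace ResGLnCohomology

open TwistedQuotient BigHeckeGLn

variable {n : ℕ} {K : Type} [Field K] [NumberField K] (p : ℕ) [Fact p.Prime]
  (lam : (K →+* PadicAlgCl p) → Fin n → ℤ)

/-! ### The scalars `ℤ̄_p`

Divisibility in the valuation ring `ℤ̄_p` is total: this is Mathlib's `ValuationRing.dvd_total`,
used directly below (the former local restatement `dvd_total_valuationSubring` was removed,
librarian dedup-02348 / dedup-02606). -/

/-- `p ≠ 0` in `ℤ̄_p`. [folklore] -/
theorem natCast_prime_ne_zero_valuationSubring :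
    ((p : ℕ) : (PadicAlgCl.valued p).v.valuationSubring) ≠ 0 := by
  intro h
  have h' := congrArg (fun x : (PadicAlgCl.valued p).v.valuationSubring => (x : PadicAlgCl p)) h
  push_cast at h'
  exact (Fact.out : p.Prime).ne_zero (by exact_mod_cast h')

/-- `p` is a non-zero-divisor of `ℤ̄_p`. [folklore] -/
theorem isLeftRegular_natCast_prime_valuationSubring :
    IsLeftRegular ((p : ℕ) : (PadicAlgCl.valued p).v.valuationSubring) :=
  (IsRegular.of_ne_zero (natCast_prime_ne_zero_valuationSubring p)).left

/-- A `ℚ̄_p`-vector space has no `p`-torsion over `ℤ̄_p`. [folklore] -/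
theorem smul_natCast_prime_eq_zero {V : Type*} [AddCommGroup V] [Module (PadicAlgCl p) V]
    (v : V) (hv : ((p : ℕ) : (PadicAlgCl.valued p).v.valuationSubring) • v = 0) : v = 0 := by
  rw [Subring.smul_def] at hv
  push_cast at hv
  rcases smul_eq_zero.1 hv with h | h
  · exact absurd h (Nat.cast_ne_zero.2 (Fact.out : p.Prime).ne_zero)
  · exact h

/-! ### The coefficient representation over `ℤ̄_p` and the Hecke elements -/

/-- The restriction of scalars of `ρ_p` is trivial on `t_{v,i}` for `v ∤ p`. [folklore] -/
theorem resScalars_padicCoeffRep_sndHom_heckeDiagAt {v : HeightOneSpectrum (𝓞 K)}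
    (hv : ((p : ℕ) : 𝓞 K) ∉ v.asIdeal) (ϖ : (v.adicCompletion K)ˣ) (i : ℕ) :
    resScalars (PadicAlgCl.valued p).v.valuationSubring (padicCoeffRep n K p lam)
      (GLn.sndHom n K (heckeDiagAt n K v ϖ i)) = 1 := by
  refine LinearMap.ext fun x => ?_
  rw [resScalars_apply, padicCoeffRep_sndHom_heckeDiagAt p lam hv ϖ i]
  rfl

/-- The ideal `(p)` of `𝓞 K` is non-zero. [folklore] -/
theorem span_natCast_prime_ne_zero : (Ideal.span {((p : ℕ) : 𝓞 K)} : Ideal (𝓞 K)) ≠ 0 := by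
  rw [Ne, Ideal.zero_eq_bot, Ideal.span_singleton_eq_bot]
  exact_mod_cast (Fact.out : p.Prime).ne_zero

omit [Fact p.Prime] [NumberField K] in
/-- A place not containing `p` does not contain the ideal `(p)`. [folklore] -/
theorem not_span_le_of_not_mem {v : HeightOneSpectrum (𝓞 K)} (hv : ((p : ℕ) : 𝓞 K) ∉ v.asIdeal) :
    ¬ (Ideal.span {((p : ℕ) : 𝓞 K)} : Ideal (𝓞 K)) ≤ v.asIdeal := fun h =>
  hv (h (Ideal.subset_span rfl))

/-! ### The instantiation -/

/-- **An integral eigenclass of bounded content is a `ℤ̄_p`-point of the big Hecke algebra of the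
`p`-power principal congruence tower.**  For an open compact `U₀ ≤ GL_n(𝒪̂_K)` hyperspecial at the
places of a set `good` of places not over `p`, a `ℤ̄_p`-lattice `M ⊂ ⨂_τ V_{λ_τ}(ℚ̄_p)` free of
finite rank and stable under `U₀`, such that for every `t'` some `U₀ ∩ K_f((p)^r)` acts trivially on
`M/p^{t'}`, and an eigenclass `c ∈ H^q(GL_n(K), M̃)` of the `[U₀ t_{v,i}(ϖ_v) U₀]`, `v` good,
`1 ≤ i ≤ n`, with eigenvalues `b_{v,i}` and content `≤ m₀`: `(t_{v,i}(ϖ_v)) ↦ (b_{v,i})` is a Hecke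
point (`IsHeckePoint`) of the tower `LevelTower.ofSeq U₀ (K((p)^·).map sndHom)` over `ℤ̄_p`.
[cite: Scholze2015, §V.4, proofs of Thm. V.4.1 and Cor. V.4.2] [cite: Emerton2006, §2.2 and §2.3] -/
theorem isHeckePoint_principalPowerTower_of_intFun_eigenclass
    (good : HeightOneSpectrum (𝓞 K) → Prop)
    (hgood : ∀ v, good v → ((p : ℕ) : 𝓞 K) ∉ v.asIdeal)
    {U₀ : Subgroup (FiniteAdelicGL n K)} (hU₀o : IsOpen (U₀ : Set (FiniteAdelicGL n K)))
    (hU₀c : IsCompact (U₀ : Set (FiniteAdelicGL n K))) (hU₀ : U₀ ≤ glFiniteIntegralLevel n K)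
    (hU₁ : ∀ v, good v → ∀ g ∈ valuedCongruenceSubgroup (Fin n) (1 : WithZero (Multiplicative ℤ)),
      ofLocal n K v g ∈ U₀)
    (M : Submodule (PadicAlgCl.valued p).v.valuationSubring (CoeffModule (PadicAlgCl p) n K lam))
    (hM : ∀ u ∈ U₀, ∀ m ∈ M,
      resScalars (PadicAlgCl.valued p).v.valuationSubring (padicCoeffRep n K p lam) u m ∈ M)
    {d : ℕ} (e : M ≃ₗ[(PadicAlgCl.valued p).v.valuationSubring]
      (Fin d → (PadicAlgCl.valued p).v.valuationSubring))
    (hmod : ∀ t' : ℕ, ∃ r : ℕ,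
      ModTrivialOn (resScalars (PadicAlgCl.valued p).v.valuationSubring (padicCoeffRep n K p lam))
        M hM (p ^ t')
        (U₀ ⊓ (principalCongruenceLevel n K (Ideal.span {((p : ℕ) : 𝓞 K)} ^ r)).comap
          (GLn.ofFinite n K)))
    (ϖ : ∀ v : HeightOneSpectrum (𝓞 K), (v.adicCompletion K)ˣ)
    (b : {v // good v} → ℕ → (PadicAlgCl.valued p).v.valuationSubring) {q : ℕ}
    (c : groupCohomology (intFun (globalEmbedding n K) U₀
      (resScalars (PadicAlgCl.valued p).v.valuationSubring (padicCoeffRep n K p lam)) M) q)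
    (heig : ∀ j : {v // good v} × Fin n,
      (groupCohomology.map (MonoidHom.id (GL (Fin n) K))
        (A := intFun (globalEmbedding n K) U₀
          (resScalars (PadicAlgCl.valued p).v.valuationSubring (padicCoeffRep n K p lam)) M)
        (B := intFun (globalEmbedding n K) U₀
          (resScalars (PadicAlgCl.valued p).v.valuationSubring (padicCoeffRep n K p lam)) M)
        (heckeIntHom (globalEmbedding n K) U₀
          (resScalars (PadicAlgCl.valued p).v.valuationSubring (padicCoeffRep n K p lam)) M hM
          (rep_mem_of_eq_one _ M
            (resScalars_padicCoeffRep_sndHom_heckeDiagAt p lam (hgood _ j.1.2) (ϖ j.1.1)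
              (j.2.val + 1)))) q).hom c = b j.1 (j.2.val + 1) • c)
    {m₀ : ℕ} (hcont : ∀ (u : ℕ) (y : groupCohomology (intFun (globalEmbedding n K) U₀
      (resScalars (PadicAlgCl.valued p).v.valuationSubring (padicCoeffRep n K p lam)) M) q),
      ((p : ℕ) : (PadicAlgCl.valued p).v.valuationSubring) ^ u • c ≠
        ((p : ℕ) : (PadicAlgCl.valued p).v.valuationSubring) ^ (u + m₀) • y) :
    IsHeckePoint (globalEmbedding n K)
      (LevelTower.ofSeq U₀ fun r : ℕ =>
        (principalCongruenceLevel n K (Ideal.span {((p : ℕ) : 𝓞 K)} ^ r)).map (GLn.sndHom n K))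
      ((p : ℕ) : (PadicAlgCl.valued p).v.valuationSubring)
      (fun j : {v // good v} × Fin n =>
        GLn.sndHom n K (heckeDiagAt n K j.1.1 (ϖ j.1.1) (j.2.val + 1)))
      (fun j => b j.1 (j.2.val + 1)) := by
  -- notation
  set T : LevelTower (FiniteAdelicGL n K) := LevelTower.ofSeq U₀ fun r : ℕ =>
    (principalCongruenceLevel n K (Ideal.span {((p : ℕ) : 𝓞 K)} ^ r)).map (GLn.sndHom n K) with hT
  have h𝔭 := span_natCast_prime_ne_zero (K := K) p
  have hlevel : ∀ r : ℕ, T.level r = U₀ ⊓ (principalCongruenceLevel n K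
      (Ideal.span {((p : ℕ) : 𝓞 K)} ^ r)).comap (GLn.ofFinite n K) := fun r =>
    ofSeq_comap_principalCongruenceLevel_pow_level h𝔭 U₀ r
  -- the Hecke elements are local: `δ j = ι_v(a_j)`
  have hδ : ∀ j : {v // good v} × Fin n,
      GLn.sndHom n K (heckeDiagAt n K j.1.1 (ϖ j.1.1) (j.2.val + 1)) =
        ofLocal n K j.1.1 (glDiagonal n (j.1.1.adicCompletion K)
          fun k => if (k : ℕ) < j.2.val + 1 then ϖ j.1.1 else 1) := fun j =>
    sndHom_heckeDiagAt_eq_ofLocal _ _ _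
  refine isHeckePoint_of_intFun_eigenclass (globalEmbedding n K) T p
    (resScalars (PadicAlgCl.valued p).v.valuationSubring (padicCoeffRep n K p lam)) U₀ M hM
    (fun j : {v // good v} × Fin n => GLn.sndHom n K (heckeDiagAt n K j.1.1 (ϖ j.1.1) (j.2.val + 1)))
    (fun j => b j.1 (j.2.val + 1)) (fun a b => ValuationRing.dvd_total a b)
    (isLeftRegular_natCast_prime_valuationSubring p) (smul_natCast_prime_eq_zero p) e
    (fun j => resScalars_padicCoeffRep_sndHom_heckeDiagAt p lam (hgood _ j.1.2) (ϖ j.1.1) _)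
    (fun j => finite_doubleCosetQuot hU₀o hU₀c _) (fun t' => ?_) c heig hcont
  -- the level data at `t'`
  obtain ⟨r, hr⟩ := hmod t'
  have hle : T.level r ≤ U₀ := by rw [hlevel]; exact inf_le_left
  refine ⟨r, hle, ?_, ?_, fun j u => ?_, fun j => ?_, fun j => ?_⟩
  · rw [hlevel]; exact normal_inf_comap_principalCongruenceLevel_subgroupOf hU₀ _
  · -- `ModTrivialOn` at `T.level r = U₀ ∩ K_f((p)^r)`
    intro l hl m
    exact hr l (by rw [← hlevel]; exact hl) m
  · obtain ⟨-, hconj, -, -⟩ := levelData_inf_comap_principalCongruenceLevel hU₀o hU₀c hU₀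
      (hU₁ _ j.1.2) (pow_ne_zero r h𝔭) (not_dvd_pow_of_not_le (not_span_le_of_not_mem p
        (hgood _ j.1.2)) r)
      (glDiagonal n (j.1.1.adicCompletion K) fun k => if (k : ℕ) < j.2.val + 1 then ϖ j.1.1 else 1)
    obtain ⟨x, hx, y, hy, hxy⟩ := hconj u
    refine ⟨x, by rw [hlevel]; exact hx, y, by rw [hlevel]; exact hy, ?_⟩
    rw [hδ]
    exact hxy
  · obtain ⟨-, -, hbij, -⟩ := levelData_inf_comap_principalCongruenceLevel hU₀o hU₀c hU₀
      (hU₁ _ j.1.2) (pow_ne_zero r h𝔭) (not_dvd_pow_of_not_le (not_span_le_of_not_mem p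
        (hgood _ j.1.2)) r)
      (glDiagonal n (j.1.1.adicCompletion K) fun k => if (k : ℕ) < j.2.val + 1 then ϖ j.1.1 else 1)
    rw [hδ]
    convert hbij using 2 <;> first | rfl | exact hlevel r
  · obtain ⟨-, -, -, hfin⟩ := levelData_inf_comap_principalCongruenceLevel hU₀o hU₀c hU₀
      (hU₁ _ j.1.2) (pow_ne_zero r h𝔭) (not_dvd_pow_of_not_le (not_span_le_of_not_mem p
        (hgood _ j.1.2)) r)
      (glDiagonal n (j.1.1.adicCompletion K) fun k => if (k : ℕ) < j.2.val + 1 then ϖ j.1.1 else 1)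
    rw [hδ, hlevel]
    exact hfin

end ResGLnCohomology

end Literature.NumberTheory.Automorphic
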